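import Summits.AtomisticToContinuum.HydrodynamicLimit.Theses.JParityClosure
import Literature.MathematicalPhysics.KineticTheory.MicroscaleWindowFunctionals
import Literature.Analysis.FluidPDE.EmpiricalCollisionMeasure
import Summits.AtomisticToContinuum.HydrodynamicLimit.Theorems.JParityClosureEvenStressEnskogQuadraticTestConvergence
import Summits.AtomisticToContinuum.HydrodynamicLimit.Theorems.JParityClosureEvenStressEnskogVelocityEquilibrationRung0MaxwellianContinuity
import HarnessLib

/-!
# TYPED PLAN for stub S3c `stub_kineticSlavingOfTools` (line `preshock-kinetic-slaving`, crux
# `JParityClosure.EvenStressEnskog`, stmt-AtomisticToContinuum-13079) — worker S3c, lead c7 wave 2, 2026-08-17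

EVIDENCE FILE (not proposed: it carries `sorry` in the `Iₖ_holds` of the unproved intermediates).  Companion of the
verdict `work/stubs/KineticSlavingAudit.md` (VERDICT: `stub-misstated` — two a-priori antecedents are missing from
`KineticHalf`).  Contents:

* §1 local copies of the texts: `KineticHalf'`, `VelocityEquilibrationPreShock'` (registered conclusion, verbatim),
  `QuadraticTestConvergence'` (S3a, landed p140362), `VelocityEquilibrationRung0'` (S3b);
* §2 the two MISSING ANTECEDENTS: (A) moment tightness of the empirical collision measure — the board item
  stmt-13354 `LimitCollisionMeasure.CollisionTightness` BY NAME (text copied as `CollisionMomentTightness'`; its minimal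
  sufficient pre-shock second-moment form is recorded as `CollisionEnergyTailsPreShock'`, hazard h4) and (C) MESOSCALE
  COMPACTNESS of the `r`-window laws (`MesoscaleCompactnessPreShock'`: `L¹(ds dx)` space–time modulus UNIFORM in `r < r₀`,
  hazard h6 = the Young-mixing obstruction of `Cruxes/ParityBandClosure/Lines/SketchDead.md`, kernel-checked toy p141493),
  bundled as `KineticAprioriPreShock' := CollisionMomentTightness' ∧ MesoscaleCompactnessPreShock'`;
* §3 five intermediates `I₁ … I₅` with SIZE / leans-on / why-true docstrings:
  `I₁ DiracLimitContinuity` (M, PROVED — first mile, landed p147678 as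
  `Theorems/JParityClosureEvenStressEnskogKineticSlavingDiracLimit.lean`, proof re-threaded here; the measure-level H-fold
  of `I₄` step (iv) is landed as `Theorems/JParityClosureEvenStressEnskogKineticSlavingMetropolisFold.lean`, p148656),
  `I₂ FreeCollisionalBalanceKN` (M, from `empiricalEnskogIdentity_proof`), `I₃ DiagonalParityRigidity` (L, new analysis
  on top of the internals of `parityRigidity_proof`), `I₄ KineticCoreBdd` (XL — LITERALLY the soft core: random tagged
  Young-measure limits, H-fold, floor, rigidity, for BOUNDED test functions; honest last soft step),
  `I₅ SecondMomentUpgrade` (L, truncation + `KineticEnergyTails` + S3a);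
* §4 the composition `kineticSlaving_of_plan` (kernel-checked) and the corrected registered shape
  `kineticSlavingOfTools_corrected : S3a → S3b → KineticHalf' → KineticAprioriPreShock' → VelocityEquilibrationPreShock'`.
-/

noncomputable section

namespace Summit.AtomisticToContinuum.HydrodynamicLimit.Theorems.EvenStressEnskog.KineticSlavingPlan

open scoped BigOperators InnerProductSpace Topology ENNReal
open MeasureTheory ProbabilityTheory Filter Set
open Literature.MathematicalPhysics.KineticTheory Literature.Analysis.FluidPDE
open Literature.MathematicalPhysics.KineticTheory.StationaryMicroscale
open Summit.AtomisticToContinuum.HydrodynamicLimit.Theses.JParityClosure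

/-! ## §1 Local copies of the registered texts -/

/-- `KineticHalf` of the skeleton, verbatim: the six route items by name. [folklore] -/
def KineticHalf' : Prop :=
  OddContactSymmetry ∧ RateFloor ∧ LocalSecondLaw ∧ DensityCap ∧ CollisionTightness ∧ KineticEnergyTails

/-- `VelocityEquilibrationPreShock` of the skeleton, verbatim (the registered conclusion of S3c). [folklore] -/
def VelocityEquilibrationPreShock' : Prop :=
  ∃ η₀ : ℝ, 0 < η₀ ∧ ∀ (a₀ θ₀ : T3 → ℝ) (u₀ : T3 → V3), Continuous a₀ → Continuous θ₀ → Continuous u₀ →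
    (∀ x, 0 < a₀ x) → (∀ x, 0 < θ₀ x) → ∃ σ₀ : ℝ, 0 < σ₀ ∧ ∀ σ : ℝ, 0 < σ → σ < σ₀ →
    ∀ (T : ℝ) (ρ θ : ℝ → T3 → ℝ) (u : ℝ → T3 → V3), IsHardSphereEulerSolution σ T ρ u θ →
    ∀ Φ : (N : ℕ) → HardSphereFlow (Torus.geometry (Fin 3)) (hsDiameter σ N) (N + 1),
    TendstoHydroFieldsAt (fun N => localGibbsLaw σ a₀ u₀ θ₀ N (Φ N)) Φ ρ u θ 0 →
    ∀ τ : ℝ, 0 < τ → τ < T →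
    ∀ χ : ℝ × T3 → ℝ, Continuous χ → ∀ k : ℝ → ℝ, Continuous k → (∀ a, η₀ ≤ a → k a = 0) →
    ∀ F : V3 × V3 × ℝ → ℝ, Continuous F →
    (∃ C : ℝ, ∀ q, |F q| ≤ C * (1 + ‖q.1‖ ^ 2 + ‖q.2.1‖ ^ 2 + |q.2.2|)) →
    ∀ η δ : ℝ, 0 < η → 0 < δ → ∃ r₀ : ℝ, 0 < r₀ ∧ ∀ r : ℝ, 0 < r → r < r₀ → ∃ N₀ : ℕ, ∀ N : ℕ, N₀ ≤ N →
      localGibbsLaw σ a₀ u₀ θ₀ N (Φ N)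
        {z | η < |oneBodyStat σ N (Φ N) τ χ k F r z - oneBodyPred σ N (Φ N) τ χ k F r z|}
        ≤ ENNReal.ofReal δ

/-- The same statement for BOUNDED continuous test functions (the weak-topology part of the conclusion; target of the
kinetic core `I₄`, upgraded to quadratic growth by `I₅`). [folklore] -/
def VelocityEquilibrationPreShockBdd' : Prop :=
  ∃ η₀ : ℝ, 0 < η₀ ∧ ∀ (a₀ θ₀ : T3 → ℝ) (u₀ : T3 → V3), Continuous a₀ → Continuous θ₀ → Continuous u₀ →
    (∀ x, 0 < a₀ x) → (∀ x, 0 < θ₀ x) → ∃ σ₀ : ℝ, 0 < σ₀ ∧ ∀ σ : ℝ, 0 < σ → σ < σ₀ →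
    ∀ (T : ℝ) (ρ θ : ℝ → T3 → ℝ) (u : ℝ → T3 → V3), IsHardSphereEulerSolution σ T ρ u θ →
    ∀ Φ : (N : ℕ) → HardSphereFlow (Torus.geometry (Fin 3)) (hsDiameter σ N) (N + 1),
    TendstoHydroFieldsAt (fun N => localGibbsLaw σ a₀ u₀ θ₀ N (Φ N)) Φ ρ u θ 0 →
    ∀ τ : ℝ, 0 < τ → τ < T →
    ∀ χ : ℝ × T3 → ℝ, Continuous χ → ∀ k : ℝ → ℝ, Continuous k → (∀ a, η₀ ≤ a → k a = 0) →
    ∀ F : V3 × V3 × ℝ → ℝ, Continuous F → (∃ C : ℝ, ∀ q, |F q| ≤ C) →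
    ∀ η δ : ℝ, 0 < η → 0 < δ → ∃ r₀ : ℝ, 0 < r₀ ∧ ∀ r : ℝ, 0 < r → r < r₀ → ∃ N₀ : ℕ, ∀ N : ℕ, N₀ ≤ N →
      localGibbsLaw σ a₀ u₀ θ₀ N (Φ N)
        {z | η < |oneBodyStat σ N (Φ N) τ χ k F r z - oneBodyPred σ N (Φ N) τ χ k F r z|}
        ≤ ENNReal.ofReal δ

/-- S3a `Stubs.stub_quadraticTestConvergence` of the skeleton, verbatim (LANDED p140362 as
`Theorems.EvenStressEnskog.stub_quadraticTestConvergence`). [folklore] -/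
def QuadraticTestConvergence' : Prop :=
  ∀ {ι : Type} (l : Filter ι) (μs : ι → FiniteMeasure V3) (ν : FiniteMeasure V3),
    Tendsto μs l (𝓝 ν) →
    (∀ i, Integrable (fun v : V3 => ‖v‖ ^ 2) (μs i : Measure V3)) →
    Integrable (fun v : V3 => ‖v‖ ^ 2) (ν : Measure V3) →
    Tendsto (fun i => ∫ v, ‖v‖ ^ 2 ∂(μs i : Measure V3)) l (𝓝 (∫ v, ‖v‖ ^ 2 ∂(ν : Measure V3))) →
    ∀ F : V3 → ℝ, Continuous F → (∃ C : ℝ, ∀ v, |F v| ≤ C * (1 + ‖v‖ ^ 2)) →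
      Tendsto (fun i => ∫ v, F v ∂(μs i : Measure V3)) l (𝓝 (∫ v, F v ∂(ν : Measure V3)))

/-- S3a holds: the landed theorem. [folklore] -/
theorem quadraticTestConvergence'_holds : QuadraticTestConvergence' :=
  fun l μs ν h1 h2 h3 h4 F hF hC =>
    Summit.AtomisticToContinuum.HydrodynamicLimit.Theorems.EvenStressEnskog.stub_quadraticTestConvergence
      l μs ν h1 h2 h3 h4 F hF hC

/-- S3b `Stubs.stub_velocityEquilibrationRung0` of the skeleton, verbatim (rung 0; logically unused by S3c). [folklore] -/
def VelocityEquilibrationRung0' : Prop :=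
  ∃ η₀ : ℝ, 0 < η₀ ∧ ∀ (a θ : ℝ) (u : V3), 0 < a → 0 < θ → ∃ σ₀ : ℝ, 0 < σ₀ ∧ ∀ σ : ℝ, 0 < σ → σ < σ₀ →
    ∀ Φ : (N : ℕ) → HardSphereFlow (Torus.geometry (Fin 3)) (hsDiameter σ N) (N + 1),
    ∀ τ : ℝ, 0 < τ →
    ∀ χ : ℝ × T3 → ℝ, Continuous χ → ∀ k : ℝ → ℝ, Continuous k → (∀ b, η₀ ≤ b → k b = 0) →
    ∀ F : V3 × V3 × ℝ → ℝ, Continuous F →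
    (∃ C : ℝ, ∀ q, |F q| ≤ C * (1 + ‖q.1‖ ^ 2 + ‖q.2.1‖ ^ 2 + |q.2.2|)) →
    ∀ η δ : ℝ, 0 < η → 0 < δ → ∃ r₀ : ℝ, 0 < r₀ ∧ ∀ r : ℝ, 0 < r → r < r₀ → ∃ N₀ : ℕ, ∀ N : ℕ, N₀ ≤ N →
      localGibbsLaw σ (fun _ => a) (fun _ => u) (fun _ => θ) N (Φ N)
        {z | η < |oneBodyStat σ N (Φ N) τ χ k F r z - oneBodyPred σ N (Φ N) τ χ k F r z|}
        ≤ ENNReal.ofReal δ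

/-! ## §2 The two missing a-priori antecedents (hazards h4 and h6 of the audit) -/

/-- **(A) MOMENT TIGHTNESS OF THE NORMALISED COLLISION MEASURE** — the board item stmt-AtomisticToContinuum-13354
`Summit.AtomisticToContinuum.HydrodynamicLimit.Theses.LimitCollisionMeasure.CollisionTightness`, text VERBATIM (to be cited
BY NAME in the skeleton, like the conjuncts of `KineticHalf`): for local Gibbs data, every `τ`, the
`(1 + |v⁻|⁴ + |w⁻|⁴)(1 + 1/(π|v⁻ − w⁻|))`-moment of `(ε/(N+1)) κ^N` is bounded in probability.  It implies the minimal
form `CollisionEnergyTailsPreShock'` below (`(a + b − M)₊ ≤ 2(a² + b²)/M`) and is what the sister crux 17608's dead line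
consumed for the same purpose (`stub_maxwellDefectTight`, p138337).  Untied / `∀ τ` frame (stronger than needed). [folklore] -/
def CollisionMomentTightness' : Prop :=
  ∀ (a₀ θ₀ : T3 → ℝ) (u₀ : T3 → V3), Continuous a₀ → Continuous θ₀ → Continuous u₀ → (∀ x, 0 < a₀ x) →
    (∀ x, 0 < θ₀ x) → ∃ σ₀ : ℝ, 0 < σ₀ ∧ ∀ σ : ℝ, 0 < σ → σ < σ₀ →
    ∀ Φ : (N : ℕ) → HardSphereFlow (Torus.geometry (Fin 3)) (hsDiameter σ N) (N + 1), ∀ τ : ℝ, 0 < τ →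
    ∀ δ : ℝ, 0 < δ → ∃ Kb : ℝ, ∃ N₀ : ℕ, ∀ N : ℕ, N₀ ≤ N →
      localGibbsLaw σ a₀ u₀ θ₀ N (Φ N)
        {z | Kb < hsDiameter σ N / (N + 1 : ℝ) *
          ∫ m, (1 + ‖m.2.2.2.1‖ ^ 4 + ‖m.2.2.2.2‖ ^ 4) * (1 + 1 / (Real.pi * ‖m.2.2.2.1 - m.2.2.2.2‖))
            ∂((Φ N).empiricalCollisionMeasure (Set.Icc 0 τ) z)} ≤ ENNReal.ofReal δ

/-- **(A, minimal sufficient form) COLLISION ENERGY TAILS, PRE-SHOCK** (hazard h4).  Along forward local-Gibbs evolutions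
tied to a classical hs-Euler solution on `[0,T)` by the `t = 0` LLN, for `τ < T`: the collision sum (the crux's `K_N`,
tree `collisionSum` with `χ ≡ 1`, `g ≡ 1`, so `r` is inert) of the continuous second-moment tail mark
`(n, v⁻, w⁻) ↦ (‖v⁻‖² + ‖w⁻‖² − M)₊` is `η`-small with probability `1 − δ` for `M ≥ M(η,δ)`, `N ≥ N₀`: uniform
integrability of `‖v‖² + ‖w‖²` against the EMPIRICAL COLLISION MEASURE.  Consumed three times by the kinetic core:
weak (not vague) subsequential limits of the collision measures (free balance survives for bounded one-body
observables), admissibility of the quadratic-growth surprisal marks `log h̄` in the H-fold (truncation error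
`(R/ϑ²)·κ̄{‖v‖²+‖w‖² > R} → 0`), impulse tightness `K_N[‖v−w‖] = O_P(1)`.  NOT supplied by
`JParityClosure.CollisionTightness` (mass only) + `KineticEnergyTails` (one-time particle average): heuristically it is a
CUBIC velocity moment of the one-body law (`σ³∫∫(‖v‖²+‖w‖²)‖v−w‖ff_*`), and pathwise a fast particle rattling in a
sub-`ε` cage has unbounded collision count.  Same input as `(H_K)` of the dead line even-rung-mean-variance
(`stub_velocityTruncationOfTails`, rung 0 proved `stub_velocityTailCollisionSumRung0`); implied by `CollisionMomentTightness'`.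
[folklore] -/
def CollisionEnergyTailsPreShock' : Prop :=
  ∀ (a₀ θ₀ : T3 → ℝ) (u₀ : T3 → V3), Continuous a₀ → Continuous θ₀ → Continuous u₀ →
    (∀ x, 0 < a₀ x) → (∀ x, 0 < θ₀ x) → ∃ σ₀ : ℝ, 0 < σ₀ ∧ ∀ σ : ℝ, 0 < σ → σ < σ₀ →
    ∀ (T : ℝ) (ρ θ : ℝ → T3 → ℝ) (u : ℝ → T3 → V3), IsHardSphereEulerSolution σ T ρ u θ →
    ∀ Φ : (N : ℕ) → HardSphereFlow (Torus.geometry (Fin 3)) (hsDiameter σ N) (N + 1),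
    TendstoHydroFieldsAt (fun N => localGibbsLaw σ a₀ u₀ θ₀ N (Φ N)) Φ ρ u θ 0 →
    ∀ τ : ℝ, 0 < τ → τ < T →
    ∀ η δ : ℝ, 0 < η → 0 < δ → ∃ M : ℝ, ∃ N₀ : ℕ, ∀ N : ℕ, N₀ ≤ N →
      localGibbsLaw σ a₀ u₀ θ₀ N (Φ N)
        {z | η < collisionSum σ N (Φ N) τ (fun _ => 1) (fun _ => 1)
              (fun q => max (‖q.2.1‖ ^ 2 + ‖q.2.2‖ ^ 2 - M) 0) 1 z} ≤ ENNReal.ofReal δ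

/-- **(C) MESOSCALE COMPACTNESS OF THE WINDOW LAWS, PRE-SHOCK** (hazard h6).  Same tied frame; for every bounded
continuous velocity test `φ` the `r`-window statistic `W^{N,r}_φ(s,x) = ∫ b_r(y,x) φ(v) dμ_{Φ_s z}(y,v)` has an
`L¹(ds dx)` SPACE–TIME modulus of continuity in probability that is UNIFORM IN THE SCALE `r < r₀`:
`P{η < ∫₀^τ∫ |W(s+l, x+y) − W(s,x)| dx ds} ≤ δ` for all lags `0 < l < λ₀`, shifts `dist y 0 < λ₀`, `r < r₀`, `N ≥ N₀(r,l,y)`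
(`∫⁻`-form, no Bochner junk).  By Kolmogorov–Riesz this is strong `L¹` precompactness of the family
`{W^{N,r}_φ : N ≥ N₀(r), r < r₀}`, i.e. NO OSCILLATION OF THE LOCAL VELOCITY LAW AT ANY MESOSCALE `r ≪ ℓ ≪ 1` in space or
in time: along the diagonal `N → ∞, r → 0` the Young measure of window laws over `(s,x)` is TRIVIAL (one law per
point).  This is exactly what defeats the two-fibre counter-models of the sister crux's dead line
(`Cruxes/ParityBandClosure/Lines/SketchDead.md` §2–§3, toy kernel-checked p141493): with fixed test functions,
`OddContactSymmetry` / `RateFloor` / balance constrain only fibre AVERAGES, and averaged Metropolis `J`-invariance (resp.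
averaged floors) do not give fibrewise detailed balance (resp. thickness).  At FIXED `r` the `x`-modulus at scale
`≲ r` is free (`b_r` Lipschitz) but not at scales `ℓ ≫ r`, and the time-modulus is never free (collisions reshape the law
at rate `N^{1/3}`; only `(ρ_r,u_r,e_r)` are Lipschitz in `s`).  Not derivable from `KineticHalf` (all its items are
fixed-test, time-integrated or one-time marginals).  Physically it is first-order-in-Kn local-equilibrium information
(pre-shock the fields are smooth); the ALTERNATIVE repair is item-side (planner): re-type 17722 with odd marks of the
surprisal jump (`SketchRepair.lean`, consumer landed p141247) AND 13080 window-by-window — which removes the spatial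
fibres but (audit h6) still leaves temporal sub-window fibres, so some time-regularity input remains. [folklore] -/
def MesoscaleCompactnessPreShock' : Prop :=
  ∀ (a₀ θ₀ : T3 → ℝ) (u₀ : T3 → V3), Continuous a₀ → Continuous θ₀ → Continuous u₀ →
    (∀ x, 0 < a₀ x) → (∀ x, 0 < θ₀ x) → ∃ σ₀ : ℝ, 0 < σ₀ ∧ ∀ σ : ℝ, 0 < σ → σ < σ₀ →
    ∀ (T : ℝ) (ρ θ : ℝ → T3 → ℝ) (u : ℝ → T3 → V3), IsHardSphereEulerSolution σ T ρ u θ →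
    ∀ Φ : (N : ℕ) → HardSphereFlow (Torus.geometry (Fin 3)) (hsDiameter σ N) (N + 1),
    TendstoHydroFieldsAt (fun N => localGibbsLaw σ a₀ u₀ θ₀ N (Φ N)) Φ ρ u θ 0 →
    ∀ τ : ℝ, 0 < τ → τ < T →
    ∀ φ : V3 → ℝ, Continuous φ → (∃ C : ℝ, ∀ v, |φ v| ≤ C) →
    ∀ η δ : ℝ, 0 < η → 0 < δ → ∃ l₀ : ℝ, 0 < l₀ ∧ ∃ r₀ : ℝ, 0 < r₀ ∧
    ∀ r : ℝ, 0 < r → r < r₀ → ∀ l : ℝ, 0 < l → l < l₀ → ∀ y : T3, dist y 0 < l₀ → ∃ N₀ : ℕ, ∀ N : ℕ, N₀ ≤ N →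
      localGibbsLaw σ a₀ u₀ θ₀ N (Φ N)
        {z | ENNReal.ofReal η < ∫⁻ s in Set.Icc (0 : ℝ) τ, ∫⁻ x : T3, ENNReal.ofReal
              |(∫ q, coneKernel r q.1 (x + y) * φ q.2 ∂(empiricalMeasure ((Φ N).flow (s + l) z))) -
                (∫ q, coneKernel r q.1 x * φ q.2 ∂(empiricalMeasure ((Φ N).flow s z)))|} ≤ ENNReal.ofReal δ

/-- The bundle of the two missing antecedents (the corrected signature adds exactly this). [folklore] -/
def KineticAprioriPreShock' : Prop :=
  CollisionMomentTightness' ∧ MesoscaleCompactnessPreShock'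

/-! ## §3 Intermediates -/

/-- **I₁ · DIRAC-LIMIT CONTINUITY OF THE MAXWELLIAN PAIRING** (hazard h1).  SIZE M — PROVED this run
(`Theorems.EvenStressEnskog.tendsto_integral_mul_localMaxwellian_nhdsWithin_zero`, file
`Theorems/JParityClosureEvenStressEnskogKineticSlavingDiracLimit.lean`; proof re-threaded below so that this evidence file
does not depend on the farm build of a freshly landed module).  Why true: `M_{1,θ',u'}` is an approximate identity; in
the standard-Gaussian form `∫ F(u' + √θ' w, u', θ') dN(0,id)` dominated convergence applies up to `θ' = 0`.  Role: the
one-body defect `Stat − Pred` extends by `0` to cold-spot (Dirac) window laws along positive temperatures, so the junk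
`localMaxwellian 1 0 u ≡ 0` never enters and `KineticHalf` need not exclude Dirac limits.  Leans on:
`integral_localMaxwellian_mul_eq_integral_gaussMeasure`, `integral_gaussMeasure`, `continuousAt_of_dominated`. [folklore] -/
def DiracLimitContinuity : Prop :=
  ∀ {F : V3 × V3 × ℝ → ℝ}, Continuous F →
    (∃ C : ℝ, ∀ q, |F q| ≤ C * (1 + ‖q.1‖ ^ 2 + ‖q.2.1‖ ^ 2 + |q.2.2|)) →
    ∀ u : V3,
      Tendsto (fun p : V3 × ℝ => ∫ v, F (v, p.1, p.2) * localMaxwellian 1 p.2 p.1 v)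
        (𝓝[{p : V3 × ℝ | 0 < p.2}] (u, 0)) (𝓝 (F (u, u, 0)))

/-- Continuity at `(u, 0)` of the standard-Gaussian form of the pairing (dominated convergence; the landed
`continuousAt_integral_gaussShift_zero`, re-proved). [folklore] -/
theorem continuousAt_gaussShift_zero {F : V3 × V3 × ℝ → ℝ} (hF : Continuous F)
    (hC : ∃ C : ℝ, ∀ q, |F q| ≤ C * (1 + ‖q.1‖ ^ 2 + ‖q.2.1‖ ^ 2 + |q.2.2|)) (u : V3) :
    ContinuousAt (fun p : V3 × ℝ => ∫ w, F (p.1 + Real.sqrt p.2 • w, p.1, p.2) ∂stdGaussian V3)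
      (u, 0) := by
  obtain ⟨C, hC⟩ := hC
  have hC0 : 0 ≤ C := by
    have h := hC ((0 : V3), (0 : V3), (0 : ℝ))
    simp only [norm_zero, abs_zero] at h
    have : (0 : ℝ) ≤ C * (1 + 0 ^ 2 + 0 ^ 2 + 0) := (abs_nonneg _).trans h
    linarith
  set U : ℝ := ‖u‖ + 1 with hU
  have hsq : Integrable (fun w : V3 => ‖w‖ ^ 2) (stdGaussian V3) :=
    (IsGaussian.memLp_id _ 2 (by simp)).integrable_norm_pow (by norm_num)
  have hball : ∀ᶠ p : V3 × ℝ in 𝓝 (u, (0 : ℝ)), ‖p.1‖ ≤ U ∧ |p.2| ≤ 1 := by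
    have h1 : ∀ᶠ p : V3 × ℝ in 𝓝 (u, (0 : ℝ)), dist p.1 u < 1 :=
      Metric.tendsto_nhds.1 ((continuous_fst (X := V3) (Y := ℝ)).tendsto (u, 0)) 1 one_pos
    have h2 : ∀ᶠ p : V3 × ℝ in 𝓝 (u, (0 : ℝ)), dist p.2 0 < 1 :=
      Metric.tendsto_nhds.1 ((continuous_snd (X := V3) (Y := ℝ)).tendsto (u, 0)) 1 one_pos
    filter_upwards [h1, h2] with p hp1 hp2
    rw [dist_eq_norm] at hp1
    rw [Real.dist_eq, sub_zero] at hp2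
    constructor
    · calc ‖p.1‖ = ‖(p.1 - u) + u‖ := by rw [sub_add_cancel]
        _ ≤ ‖p.1 - u‖ + ‖u‖ := norm_add_le _ _
        _ ≤ U := by rw [hU]; linarith
    · exact hp2.le
  refine continuousAt_of_dominated
    (bound := fun w : V3 => C * (1 + 3 * U ^ 2 + 1 + 2 * ‖w‖ ^ 2)) ?_ ?_ ?_ ?_
  · refine Eventually.of_forall fun p => Continuous.aestronglyMeasurable ?_
    have hc : Continuous fun w : V3 => (p.1 + Real.sqrt p.2 • w, p.1, p.2) := by fun_prop
    exact hF.comp hc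
  · filter_upwards [hball] with p hp
    refine ae_of_all _ fun w => ?_
    rw [Real.norm_eq_abs]
    refine (hC _).trans ?_
    dsimp only
    have h1 := norm_add_smul_sq_le p.1 w (Real.sqrt p.2)
    have h2 : Real.sqrt p.2 ^ 2 ≤ 1 := (sq_sqrt_le_abs p.2).trans hp.2
    have h3 : ‖p.1‖ ^ 2 ≤ U ^ 2 := pow_le_pow_left₀ (norm_nonneg _) hp.1 2
    have h4 : Real.sqrt p.2 ^ 2 * ‖w‖ ^ 2 ≤ 1 * ‖w‖ ^ 2 :=
      mul_le_mul_of_nonneg_right h2 (sq_nonneg _)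
    refine mul_le_mul_of_nonneg_left ?_ hC0
    nlinarith [hp.2, sq_nonneg ‖w‖]
  · exact ((integrable_const _).add (hsq.const_mul _)).const_mul _
  · refine Eventually.of_forall fun w => Continuous.continuousAt ?_
    have hc : Continuous fun p : V3 × ℝ => (p.1 + Real.sqrt p.2 • w, p.1, p.2) :=
      (continuous_fst.add ((Real.continuous_sqrt.comp continuous_snd).smul continuous_const)).prodMk
        (continuous_fst.prodMk continuous_snd)
    exact hF.comp hc

/-- `I₁` holds (PROVED; same proof as the landed first mile). [folklore] -/
theorem diracLimitContinuity_holds : DiracLimitContinuity := by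
  intro F hF hC u
  have hcont := continuousAt_gaussShift_zero hF hC u
  have hval : (∫ w, F (u + Real.sqrt 0 • w, u, (0 : ℝ)) ∂stdGaussian V3) = F (u, u, 0) := by
    simp only [Real.sqrt_zero, zero_smul, add_zero]
    rw [integral_const, smul_eq_mul]
    simp
  have hT : Tendsto (fun p : V3 × ℝ => ∫ w, F (p.1 + Real.sqrt p.2 • w, p.1, p.2) ∂stdGaussian V3)
      (𝓝[{p : V3 × ℝ | 0 < p.2}] (u, 0)) (𝓝 (F (u, u, 0))) := by
    have h : Tendsto (fun p : V3 × ℝ => ∫ w, F (p.1 + Real.sqrt p.2 • w, p.1, p.2) ∂stdGaussian V3)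
        (𝓝 (u, 0)) (𝓝 (F (u, u, 0))) := by
      have h0 := hcont.tendsto
      dsimp only at h0
      rwa [hval] at h0
    exact h.mono_left nhdsWithin_le_nhds
  refine hT.congr' ?_
  filter_upwards [self_mem_nhdsWithin] with p hp
  have hp' : 0 < p.2 := hp
  rw [← integral_gaussMeasure p.1 hp' (fun v => F (v, p.1, p.2)),
    ← integral_localMaxwellian_mul_eq_integral_gaussMeasure hp' p.1]
  exact integral_congr_ae (ae_of_all _ fun v => mul_comm _ _)

/-- **I₂ · FREE COLLISIONAL BALANCE IN `K_N` UNITS** (pathwise, deterministic).  SIZE M.  For a `C¹` time weight `a`,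
a smooth space weight `b` and ANY bounded velocity observable `c`, the collision sum of the balance mark
`(n, v⁻, w⁻) ↦ c(v⁺) − c(v⁻)` (`v⁺ = (reflectVel n (v⁻,w⁻)).1`, scale-free and involutive: `reflectVel_smul`,
`reflectVel_reflectVel`) is `O(ε_N)` on every good orbit whose initial instant is not a collision time:
`|K_N[a b Δc]| ≤ ε_N · C(a,b,‖c‖,τ) · (1 + mean kinetic energy)`.  Why true: `empiricalEnskogIdentity_proof` (PROVED)
says `N⁻¹ Σ_coll a b Δc` equals the free-transport expression `a(τ)⟨μ_τ,bc⟩ − a(0)⟨μ₀,bc⟩ − ∫(a'⟨μ,bc⟩ + a⟨μ,(v·∇b)c⟩)`,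
bounded by `‖a‖_{C¹}‖b‖_{C¹}‖c‖_∞(2 + τ + τ·mean speed)`, mean speed `≤ 1 + mean energy` (conserved along good
orbits); `K_N = ε(N/(N+1))×` that.  Role: in the limit the collision measure is BALANCED for every bounded continuous
`c(s,x,v)` (sums of products are dense; passage to the limit uses (A)).  Leans on: `empiricalEnskogIdentity_proof`,
`collisionSum`, energy conservation of `IsHardSphereTrajectory`. [folklore] -/
def FreeCollisionalBalanceKN : Prop :=
  ∀ (a : ℝ → ℝ), ContDiff ℝ 1 a → ∀ (b : T3 → ℝ), Literature.Analysis.FunctionSpaces.Torus.IsSmooth b →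
  ∀ (c : V3 → ℝ) (Cc : ℝ), (∀ v, |c v| ≤ Cc) → ∀ τ : ℝ, 0 < τ →
  ∃ C : ℝ, ∀ σ : ℝ, 0 < σ → ∀ (N : ℕ) (Φ : HardSphereFlow (Torus.geometry (Fin 3)) (hsDiameter σ N) (N + 1)),
  ∀ z ∈ Φ.good, (0 : ℝ) ∉ collisionTimes (Torus.geometry (Fin 3)) (hsDiameter σ N) (fun s => Φ.flow s z) →
  ∀ r : ℝ,
    |collisionSum σ N Φ τ (fun p => a p.1 * b p.2) (fun _ => 1)
        (fun q => c (reflectVel q.1 (q.2.1, q.2.2)).1 - c q.2.1) r z|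
      ≤ hsDiameter σ N * C * (1 + ((N : ℝ) + 1)⁻¹ * ∑ i, ‖(z i).2‖ ^ 2)

/-- `I₂` — not proved this run. [folklore] -/
theorem freeCollisionalBalanceKN_holds : FreeCollisionalBalanceKN := by
  sorry

/-- **I₃ · DIAGONAL PARITY RIGIDITY** (hazard h3).  SIZE L (new analysis; moderate risk).  The PROVED `ParityRigidity`
(`parityRigidity_proof`) identifies ONE probability measure `m` from `production(G_ϑ ∗ m; m⊗m) → 0` as `ϑ → 0⁺`.
Because `OddContactSymmetry` couples `ϑ < r₀(η,δ)` to the accuracy, the kinetic core only delivers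
`production(G_{ϑ_n} ∗ m_n; m_n⊗m_n) → 0` along `ϑ_n → 0⁺` for window laws `m_n → m` (weakly, with convergent second
moments).  Claim: then `m` is a Dirac mass or a Maxwellian.  Why true: `Φ(y) = y(1 − e^{−y}) ≥ ½ e^{−y}` on
`{y < −1}` makes `e^{−F_n}` uniformly integrable, so `∫ φ B e^{−F_n} d(m_n⊗m_n) − ∫ φ B d(m_n⊗m_n) → 0`; identifying
the first limit with `∫ φ B d(T̂_ω)_#(m⊗m)` (mollified Radon–Nikodym ratio of MOVING measures at scale `ϑ_n` — the one
estimate not in tree) gives `collide ω`-invariance of `m⊗m` for a.e. `ω`, and the landed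
`map_collide_prod_eq_of_ae_rnDeriv` / `charFun_mul_eq_of_ae` / `dirac_or_maxwellian_of_collision_invariant` conclude.
No counterexample among atoms/mixtures (isolated atoms at spacing `≫ ϑ_n` make the production `→ ∞`).  Alternative
making `I₃` unnecessary: restate `OddContactSymmetry` with `∃ ϑ₀ ∀ ϑ < ϑ₀` before `∀ η δ`.  Leans on:
Theorems/JParityClosureParityRigidity{,GaussDiff,Invariance,Phase}.lean. [folklore] -/
def DiagonalParityRigidity : Prop :=
  ∀ (ms : ℕ → Measure V3) (m : Measure V3) (ϑs : ℕ → ℝ),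
    (∀ n, IsProbabilityMeasure (ms n)) → IsProbabilityMeasure m →
    (∀ n, 0 < ϑs n) → Tendsto ϑs atTop (𝓝 0) →
    (∀ n, Integrable (fun v : V3 => ‖v‖ ^ 2) (ms n)) → Integrable (fun v : V3 => ‖v‖ ^ 2) m →
    (∀ G : V3 → ℝ, Continuous G → (∃ C : ℝ, ∀ v, |G v| ≤ C * (1 + ‖v‖ ^ 2)) →
      Tendsto (fun n => ∫ v, G v ∂(ms n)) atTop (𝓝 (∫ v, G v ∂m))) →
    (let h : ℕ → V3 → ℝ := fun n v => ∫ v', localMaxwellian 1 (ϑs n ^ 2) v v' ∂(ms n)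
     let F : ℕ → Metric.sphere (0 : V3) 1 → V3 × V3 → ℝ := fun n ω p =>
       Real.log (h n p.1) + Real.log (h n p.2) - Real.log (h n (collide ω p).1) -
         Real.log (h n (collide ω p).2)
     Tendsto (fun n => ∫⁻ p, ∫⁻ ω, ENNReal.ofReal (hardSphereKernel (p.2, p.1) ω *
        (F n ω p * (1 - Real.exp (-F n ω p)))) ∂sphereMeasure ∂((ms n).prod (ms n))) atTop (𝓝 0)) →
    (∃ u : V3, m = Measure.dirac u) ∨
      (∃ θ : ℝ, ∃ u : V3, 0 < θ ∧
        m = (volume : Measure V3).withDensity (fun v => ENNReal.ofReal (localMaxwellian 1 θ u v)))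

/-- `I₃` — not proved this run. [folklore] -/
theorem diagonalParityRigidity_holds : DiagonalParityRigidity := by
  sorry

/-- **I₄ · THE KINETIC CORE FOR BOUNDED TEST FUNCTIONS** — LITERALLY the last soft step (the composition is XL, so, as
the brief allows, this intermediate IS the implication, for bounded `F`).  SIZE XL (weeks).  Architecture (audit §h3):
fix profiles/σ/solution/flows/τ < T; suppose the conclusion fails for some bounded `F`, `(η*, δ*)`, along scales
`r_j → 0` and `N ∈ S_j`.  (i) ONE subsequence `N_k → ∞` with joint limit in law of (one-body space-time empirical
measure `μ^N`, normalised collision measure `κ^N`) — tight by energy conservation + `CollisionTightness` (vague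
topology; Mathlib Prokhorov `isCompact_closure_of_isTightMeasureSet`), weak in velocity by (A); Skorokhod.  (ii) By
(C) (Kolmogorov–Riesz, countable determining class of `φ`), instantaneous `r_j`-windows of `μ^{N}` converge for a.e.
`(s,x)` along the diagonal to ONE law `m̄_{s,x}` (trivial Young fibres — the only known way round the Young-mixing
obstruction of `Cruxes/ParityBandClosure/Lines/SketchDead.md` with the items as typed).  (iii) For each stage `j` (accuracies `η_j, δ_j → 0`, finitely many test marks,
`r_j, ϑ_j < r₀(j)`): `OddContactSymmetry` ⇒ `|∫ χ g Ψ w̄_{r_j,ϑ_j} dκ̄| ≤ η_j` with prob `≥ 1 − δ_j` (Borel–Cantelli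
over `j`; landed `stub_mapInverseCollisionOfOddIntegrals` p139072 turns exact odd vanishing into `J`-invariance);
`RateFloor` likewise; `I₂` + (A) ⇒ `κ̄` balanced for every bounded continuous `c(s,x,v)`.  (iv) H-FOLD (landed this run:
`hardSphere_ae_eq_zero_of_metropolis_invariant` / `integral_eq_half_integral_mul_one_sub_exp_neg`, file
`…KineticSlavingMetropolisFold.lean`; equality case also p138663): with `c = −log(G_{ϑ_j} ∗ m̄)` truncated ((A) controls
the tail, (C) makes `c` a continuous function of `(s,x,v)`) ⇒ `∫ χ F̄(1−e^{−F̄}) dκ̄ ≤ err_j → 0`; `RateFloor` (pointwise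
thanks to trivial fibres) ⇒ `∫∫ χ · production(G_{ϑ_j} ∗ m̄^{(r_j)}_{s,x}) dx ds → 0` (landed
`stub_productionZeroOfDetailedBalance` p139366 is the exact-case twin).
(v) `DensityCap` ⇒ bounded limit density ⇒ Lebesgue points: `m̄^{(r_j)}_{s,x} → m̄_{s,x}` a.e.; `I₃` ⇒ `m̄_{s,x}` Dirac
or Maxwellian a.e. on `{χ k ≠ 0}`.  (vi) `I₁` (Dirac branch) + continuity of the pairing at `θ > 0` (landed
`continuousAt_integral_mul_localMaxwellian`) + `KineticEnergyTails` (single-particle junk windows, audit h1) ⇒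
`lim_N ∫∫ χ k 𝒟(μ^N_{s,x,r}) = ∫∫ χ k 𝒟(m̄^{(r)}_{s,x}) → 0` as `r → 0` — contradiction.  `LocalSecondLaw` unused.
Leans on: everything above + `integrableOn_oneBodyStat_flow/_oneBodyPred_flow`, `localGibbsLaw_compl_good`. [folklore] -/
def KineticCoreBdd : Prop :=
  DiracLimitContinuity → FreeCollisionalBalanceKN → DiagonalParityRigidity →
    KineticHalf' → KineticAprioriPreShock' → VelocityEquilibrationPreShockBdd'

/-- `I₄` — not proved (XL). [folklore] -/
theorem kineticCoreBdd_holds : KineticCoreBdd := by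
  sorry

/-- **I₅ · SECOND-MOMENT UPGRADE** (bounded `F` ⇒ quadratic-growth `F`).  SIZE L.  Why true: truncate
`F = F·ζ_L(‖v‖²+‖u‖²+|θ|) + remainder`; the truncated part is bounded continuous (covered by the bounded statement
with the same `η₀`); on the `Stat` side the remainder is `≤ C ∫∫|χk| ∫ b_r (1+‖v‖²+‖u_r‖²+|θ_r|) 1{· > L} dμ`, and
windows with `‖u_r‖² + θ_r` large have `e_r > (L/6)ρ_r`, whose energy is carried by particles with `‖v‖² > L/12`
(Markov inside the window), so everything is bounded by the TAIL ENERGY per particle, small in expectation uniformly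
on `[0,τ]` by `KineticEnergyTails` (`τ < T`), then Markov + Tonelli along the flow (`measure_lt_setIntegral_flow_le`);
on the `Pred` side the Gaussian tail of `N(u_r, θ_r id)` beyond `‖v‖² > L/2` is uniformly small on
`{‖u_r‖²+θ_r ≤ √L}` and the complement is again tail energy.  S3a (`QuadraticTestConvergence'`) is the limit-object
form of the same step and is offered as a hypothesis.  Leans on: `KineticEnergyTails`, `tailEnergy`/`velTail`
(CollisionTailMarks), `mollDensity_mul_mollTemperature_le`, S3a. [folklore] -/
def SecondMomentUpgrade : Prop :=
  VelocityEquilibrationPreShockBdd' → KineticEnergyTails → QuadraticTestConvergence' → VelocityEquilibrationPreShock'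

/-- `I₅` — not proved this run. [folklore] -/
theorem secondMomentUpgrade_holds : SecondMomentUpgrade := by
  sorry

/-! ## §4 Composition (kernel-checked) -/

/-- **The plan composes**: the five intermediates give the CORRECTED implication
`S3a → S3b → KineticHalf' → KineticAprioriPreShock' → VelocityEquilibrationPreShock'` (S3b is logically idle).
[folklore] -/
theorem kineticSlaving_of_plan (h1 : DiracLimitContinuity) (h2 : FreeCollisionalBalanceKN)
    (h3 : DiagonalParityRigidity) (h4 : KineticCoreBdd) (h5 : SecondMomentUpgrade) :
    QuadraticTestConvergence' → VelocityEquilibrationRung0' → KineticHalf' → KineticAprioriPreShock' →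
      VelocityEquilibrationPreShock' :=
  fun h3a _ hK hA => h5 (h4 h1 h2 h3 hK hA) hK.2.2.2.2.2 h3a

/-- **The corrected registered shape** (what `stub_kineticSlavingOfTools` should read after the lead's reshape), reduced
to the sorried intermediates `I₂`–`I₅` and the proved `I₁`. [folklore] -/
theorem kineticSlavingOfTools_corrected :
    QuadraticTestConvergence' → VelocityEquilibrationRung0' → KineticHalf' → KineticAprioriPreShock' →
      VelocityEquilibrationPreShock' :=
  kineticSlaving_of_plan diracLimitContinuity_holds freeCollisionalBalanceKN_holds
    diagonalParityRigidity_holds kineticCoreBdd_holds secondMomentUpgrade_holds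

end Summit.AtomisticToContinuum.HydrodynamicLimit.Theorems.EvenStressEnskog.KineticSlavingPlan

end
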